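import Summits.ValiantsHypothesis.ValiantsHypothesis.Theorems.DefinabilityGapMatchingSquare
import Summits.ValiantsHypothesis.ValiantsHypothesis.Theorems.DefinabilityGapBlockRigidity
import HarnessLib

/-!
# DefinabilityGap — SQUARE PERMANENT, stage H4b: the square permanent is the top form of a specialisation

Route `route-ValiantsHypothesis-DefinabilityGap` (DRAFT), read-once leaf F4 / W10 (aside `KIPlantedHittingRO`,
stmt-ValiantsHypothesis-23704), leaf `ZperHits₂(m)`; census cell W10.rung_ladder.next ‖ v38 «branch (C)
(avoid T = ∅): max-matching top form (H4)» (decomp-valiant bus, CALL O-L5-MM; file H4b of H4a / H4b / H4c;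
continues H4a `DefinabilityGapMatchingSquare`, H2 `DefinabilityGapBlockPermanent`, E3 `DefinabilityGapLabelSupport`).

**THIS FILE.** For a cell set `T`, a permutation `σ₀` that is `T`-free on the columns `D` (H4a: a maximum
`T`-free permutation and its free columns), the SQUARE is `σ₀(D) × D`.
* `sqAvoid` — the SQUARE PERMUTATIONS: `T`-free on `D` and mapping `D` onto `σ₀(D)`; GLUING `σ|D` with `τ|Dᶜ`
  stays in `sqAvoid` (`exists_sqGlue`, H1b's `exists_gluePerm`), whence the PRODUCT FORMULA `sum_sqAvoid_eq`
  `Σ_{sqAvoid} (∏_{i ∈ D} Y_(σ i, i)) · g(σ|Dᶜ) = Q□ · Σ_{σ = σ₀ on D} g(σ)`.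
* `sqPer` — the SQUARE PERMANENT `Q□ = Σ_{σ ∈ avoid T♯} ∏_{i ∈ D} Y_(σ i, i)` (the permanent of the square
  with zeros on `T`); `zpPer T♯ = Q□ · ∏_{i ∉ D} Y_(σ₀ i, i)` (`zpPer_sharp`), so `Q□ ≠ 0` and, by H2, the
  BLOCK PERMANENTS of `T♯` at square rows divide `Q□` (`blockPer_dvd_sqPer`).
* `pad` — the PADDED PATTERN `T̂ = T ∪ (cells outside the square)`, and `outPer` — the all-variable permanent
  of `σ₀(Dᶜ) × Dᶜ`. THE POINT (`topForm_spec_pad`): under E3's injective specialisation `Φ_{T̂}` (cells of `T̂`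
  to generic constants) `Φ_{T̂}(per_m)` has degree `|D|` and TOP FORM `Q□ · ι(outPer)` — a nonzero constant
  times the square permanent — with NO hypothesis on `T` (no `T`-avoiding permutation is needed: the
  maximality count of H4a pays for the padded cells).

HONEST PLACEMENT. KNOWN mathematics: the permanent of the term-rank square and its Laplace-type
factorisation over glued permutations [cite: BrualdiRyser1991, Thm. 4.2.1, Thm. 4.2.7]; E3's specialisation /
top-form device and H2's block permanents (this lineage). Kernel-new bookkeeping only; closes NO item;
0 S-currency; rung 0; VP ≠ VNP untouched. No facts, no Prop-valued definitions, no placeholders; four data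
definitions (`sqAvoid`, `pad`, `sqPer`, `outPer`).
-/

set_option linter.dupNamespace false

open MvPolynomial Finset
open Literature.Computability.AlgebraicComplexity
open Summit.ValiantsHypothesis.ValiantsHypothesis.Theorems.DefinabilityGapUnitRigidityForms
open Summit.ValiantsHypothesis.ValiantsHypothesis.Theorems.DefinabilityGapZeroPatternPermanent
open Summit.ValiantsHypothesis.ValiantsHypothesis.Theorems.DefinabilityGapLabelSupport
open Summit.ValiantsHypothesis.ValiantsHypothesis.Theorems.DefinabilityGapAdmissibleBlocks
open Summit.ValiantsHypothesis.ValiantsHypothesis.Theorems.DefinabilityGapBlockExclusion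
open Summit.ValiantsHypothesis.ValiantsHypothesis.Theorems.DefinabilityGapBlockPermanent
open Summit.ValiantsHypothesis.ValiantsHypothesis.Theorems.DefinabilityGapMatchingSquare

namespace Summit.ValiantsHypothesis.ValiantsHypothesis.Theorems.DefinabilityGapSquarePermanent

noncomputable section

variable {m : ℕ}

/-! ## 1. Square permutations and gluing -/

/-- SQUARE PERMUTATIONS: `T`-free on `D` and mapping `D` into the matched rows `σ₀(D)`.
[cite: BrualdiRyser1991, Thm. 4.2.1] -/
def sqAvoid (T : Finset (Fin m × Fin m)) (σ₀ : Equiv.Perm (Fin m)) (D : Finset (Fin m)) :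
    Finset (Equiv.Perm (Fin m)) :=
  univ.filter fun σ => ∀ i ∈ D, (σ i, i) ∉ T ∧ σ₀.symm (σ i) ∈ D

/-- The PADDED PATTERN `T̂ = T ∪ (cells outside the square σ₀(D) × D)`. [this file] -/
def pad (T : Finset (Fin m × Fin m)) (σ₀ : Equiv.Perm (Fin m)) (D : Finset (Fin m)) :
    Finset (Fin m × Fin m) :=
  T ∪ univ.filter fun x => ¬ (σ₀.symm x.1 ∈ D ∧ x.2 ∈ D)

variable {T : Finset (Fin m × Fin m)} {σ₀ : Equiv.Perm (Fin m)} {D : Finset (Fin m)}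

/-- Membership in the square permutations. [this file] -/
theorem mem_sqAvoid {σ : Equiv.Perm (Fin m)} :
    σ ∈ sqAvoid T σ₀ D ↔ ∀ i ∈ D, (σ i, i) ∉ T ∧ σ₀.symm (σ i) ∈ D := by
  simp only [sqAvoid, mem_filter, mem_univ, true_and]

/-- A permutation mapping a finite set into itself maps exactly that set onto it. [folklore] -/
theorem perm_mem_iff {π : Equiv.Perm (Fin m)} (h : ∀ i ∈ D, π i ∈ D) (i : Fin m) : π i ∈ D ↔ i ∈ D := by
  have hsub : D.map π.toEmbedding ⊆ D := fun x hx => by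
    obtain ⟨j, hj, rfl⟩ := mem_map.1 hx
    exact h j hj
  have heq : D.map π.toEmbedding = D := eq_of_subset_of_card_le hsub (card_map _).ge
  refine ⟨fun hi => ?_, h i⟩
  rw [← heq] at hi
  obtain ⟨j, hj, hji⟩ := mem_map.1 hi
  have hji' : π j = π i := hji
  obtain rfl := π.injective hji'
  exact hj

/-- A square permutation sends a column into the matched rows iff the column is matched. [this file] -/
theorem symm_apply_mem_iff {τ : Equiv.Perm (Fin m)} (hτ : τ ∈ sqAvoid T σ₀ D) (i : Fin m) :
    σ₀.symm (τ i) ∈ D ↔ i ∈ D := by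
  have h := perm_mem_iff (D := D) (π := τ.trans σ₀.symm)
    (fun j hj => by rw [Equiv.trans_apply]; exact ((mem_sqAvoid.1 hτ) j hj).2) i
  simpa only [Equiv.trans_apply] using h

/-- The permutations avoiding `T♯` are square permutations. [this file] -/
theorem mem_sqAvoid_of_mem_avoid_sharp {σ : Equiv.Perm (Fin m)} (hσ : σ ∈ avoid (sharp T σ₀ D)) :
    σ ∈ sqAvoid T σ₀ D := by
  obtain ⟨h1, h2⟩ := mem_avoid_sharp.1 hσ
  refine mem_sqAvoid.2 fun i hi => ⟨h1 i hi, ?_⟩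
  by_contra hj
  have h3 := h2 _ hj
  rw [Equiv.apply_symm_apply] at h3
  rw [σ.injective h3] at hj
  exact hj hi

/-- `σ₀` is a square permutation. [this file] -/
theorem self_mem_sqAvoid (hfree : ∀ i ∈ D, (σ₀ i, i) ∉ T) : σ₀ ∈ sqAvoid T σ₀ D :=
  mem_sqAvoid.2 fun i hi => ⟨hfree i hi, by rw [Equiv.symm_apply_apply]; exact hi⟩

/-- GLUING of square permutations: `σ` on `D`, `τ` off `D`. [cite: BrualdiRyser1991, Thm. 4.2.7] -/
theorem exists_sqGlue {σ τ : Equiv.Perm (Fin m)} (hσ : σ ∈ sqAvoid T σ₀ D) (hτ : τ ∈ sqAvoid T σ₀ D) :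
    ∃ γ ∈ sqAvoid T σ₀ D, (∀ i ∈ D, γ i = σ i) ∧ ∀ i, i ∉ D → γ i = τ i := by
  obtain ⟨π, hπS, hπN⟩ := exists_gluePerm (S := D) (Rr := D.map σ₀.toEmbedding) (fun y => σ y)
    (fun y y' h => Subtype.ext (σ.injective h)) (fun y => mem_map_equiv.2 ((mem_sqAvoid.1 hσ) y y.2).2) τ
    (fun i => mem_map_equiv.trans (symm_apply_mem_iff hτ i))
  refine ⟨π, mem_sqAvoid.2 fun i hi => ?_, fun i hi => hπS i hi, hπN⟩
  rw [hπS i hi]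
  exact (mem_sqAvoid.1 hσ) i hi

/-! ## 2. The square permanent and the outer permanent -/

section Semiring
variable (R : Type*) [CommSemiring R]

/-- The SQUARE PERMANENT `Q□ = Σ_{σ ∈ avoid T♯} ∏_{i ∈ D} Y_(σ i, i)`: the permanent of the square
`σ₀(D) × D` of the generic matrix with zeros on `T`. [cite: BrualdiRyser1991, Thm. 4.2.1] -/
def sqPer (T : Finset (Fin m × Fin m)) (σ₀ : Equiv.Perm (Fin m)) (D : Finset (Fin m)) :
    MvPolynomial (Fin m × Fin m) R :=
  ∑ σ ∈ avoid (sharp T σ₀ D), ∏ i ∈ D, X (σ i, i)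

/-- The OUTER PERMANENT `Σ_{σ = σ₀ on D} ∏_{i ∉ D} Y_(σ i, i)`: the all-variable permanent of
`σ₀(Dᶜ) × Dᶜ`. [cite: BrualdiRyser1991, Thm. 4.2.1] -/
def outPer (T : Finset (Fin m × Fin m)) (σ₀ : Equiv.Perm (Fin m)) (D : Finset (Fin m)) :
    MvPolynomial (Fin m × Fin m) R :=
  ∑ σ ∈ (sqAvoid T σ₀ D).filter (fun σ => ∀ i ∈ D, σ i = σ₀ i), ∏ i ∈ Dᶜ, X (σ i, i)

variable {R}

/-- `zpPer T♯ = Q□ · ∏_{i ∉ D} Y_(σ₀ i, i)`. [this file] -/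
theorem zpPer_sharp (T : Finset (Fin m × Fin m)) (σ₀ : Equiv.Perm (Fin m)) (D : Finset (Fin m)) :
    zpPer R (sharp T σ₀ D) = sqPer R T σ₀ D * ∏ i ∈ Dᶜ, X (σ₀ i, i) := by
  rw [zpPer, sqPer, sum_mul]
  refine sum_congr rfl fun σ hσ => ?_
  rw [← prod_mul_prod_compl D (fun i => (X (σ i, i) : MvPolynomial (Fin m × Fin m) R))]
  exact congrArg (fun b => (∏ i ∈ D, (X (σ i, i) : MvPolynomial (Fin m × Fin m) R)) * b)
    (prod_congr rfl fun i hi => by rw [(mem_avoid_sharp.1 hσ).2 i (mem_compl.1 hi)])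

/-- `Q□ ≠ 0` (the coefficient of the `σ₀`-monomial of `zpPer T♯` is `1`). [this file] -/
theorem sqPer_ne_zero [Nontrivial R] (hfree : ∀ i ∈ D, (σ₀ i, i) ∉ T) : sqPer R T σ₀ D ≠ 0 := by
  intro h
  have h1 := coeff_permMonomial_zpPer R (sharp T σ₀ D) σ₀
  rw [if_pos (self_mem_avoid_sharp hfree), zpPer_sharp, h, zero_mul, coeff_zero] at h1
  exact zero_ne_one h1

/-- The permutations avoiding the OFF-`σ₀` PATTERN on the columns of `D` are those equal to `σ₀` on `D`.
[this file] -/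
theorem mem_avoid_offDiag {σ : Equiv.Perm (Fin m)} :
    σ ∈ avoid (univ.filter fun x : Fin m × Fin m => x.2 ∈ D ∧ σ₀ x.2 ≠ x.1) ↔ ∀ i ∈ D, σ i = σ₀ i := by
  rw [mem_avoid]
  simp only [mem_filter, mem_univ, true_and, not_and, ne_eq, not_not]
  exact ⟨fun h i hi => (h i hi).symm, fun h i hi => (h i hi).symm⟩

/-- The square permutations equal to `σ₀` on `D` = the permutations avoiding the off-`σ₀` pattern. [this file] -/
theorem filter_sqAvoid_eq (hfree : ∀ i ∈ D, (σ₀ i, i) ∉ T) :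
    (sqAvoid T σ₀ D).filter (fun σ => ∀ i ∈ D, σ i = σ₀ i) =
      avoid (univ.filter fun x : Fin m × Fin m => x.2 ∈ D ∧ σ₀ x.2 ≠ x.1) := by
  ext σ
  rw [mem_filter, mem_avoid_offDiag, mem_sqAvoid]
  constructor
  · exact fun h => h.2
  · intro h
    refine ⟨fun i hi => ?_, h⟩
    rw [h i hi, Equiv.symm_apply_apply]
    exact ⟨hfree i hi, hi⟩

/-- The zero-pattern permanent of the off-`σ₀` pattern is `(∏_{i ∈ D} Y_(σ₀ i, i)) · outPer`. [this file] -/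
theorem zpPer_offDiag (hfree : ∀ i ∈ D, (σ₀ i, i) ∉ T) :
    zpPer R (univ.filter fun x : Fin m × Fin m => x.2 ∈ D ∧ σ₀ x.2 ≠ x.1) =
      (∏ i ∈ D, X (σ₀ i, i)) * outPer R T σ₀ D := by
  rw [zpPer, outPer, filter_sqAvoid_eq hfree, mul_sum]
  refine sum_congr rfl fun σ hσ => ?_
  rw [← prod_mul_prod_compl D (fun i => (X (σ i, i) : MvPolynomial (Fin m × Fin m) R))]
  exact congrArg (fun a => a * ∏ i ∈ Dᶜ, (X (σ i, i) : MvPolynomial (Fin m × Fin m) R))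
    (prod_congr rfl fun i hi => by rw [(mem_avoid_offDiag.1 hσ) i hi])

/-- The outer permanent is nonzero. [this file] -/
theorem outPer_ne_zero [Nontrivial R] (hfree : ∀ i ∈ D, (σ₀ i, i) ∉ T) : outPer R T σ₀ D ≠ 0 := by
  intro h
  have hσ₀ : σ₀ ∈ avoid (univ.filter fun x : Fin m × Fin m => x.2 ∈ D ∧ σ₀ x.2 ≠ x.1) :=
    mem_avoid_offDiag.2 fun _ _ => rfl
  have h1 := coeff_permMonomial_zpPer R (univ.filter fun x : Fin m × Fin m => x.2 ∈ D ∧ σ₀ x.2 ≠ x.1) σ₀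
  rw [if_pos hσ₀, zpPer_offDiag hfree, h, mul_zero, coeff_zero] at h1
  exact zero_ne_one h1

/-- **PRODUCT FORMULA** on the square permutations: summing `(∏_{i ∈ D} Y_(σ i, i)) · g(σ)` with `g`
depending only on `σ|Dᶜ` gives `Q□ · Σ_{σ = σ₀ on D} g(σ)` (glue `σ|D` with `τ|Dᶜ`).
[cite: BrualdiRyser1991, Thm. 4.2.7] -/
theorem sum_sqAvoid_eq (hfree : ∀ i ∈ D, (σ₀ i, i) ∉ T)
    (g : Equiv.Perm (Fin m) → MvPolynomial (Fin m × Fin m) R)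
    (hg : ∀ σ τ : Equiv.Perm (Fin m), (∀ i, i ∉ D → σ i = τ i) → g σ = g τ) :
    ∑ σ ∈ sqAvoid T σ₀ D, (∏ i ∈ D, X (σ i, i)) * g σ =
      sqPer R T σ₀ D * ∑ σ ∈ (sqAvoid T σ₀ D).filter (fun σ => ∀ i ∈ D, σ i = σ₀ i), g σ := by
  have hσ₀ := self_mem_sqAvoid hfree
  have hex : ∀ σ ∈ sqAvoid T σ₀ D, ∀ τ ∈ sqAvoid T σ₀ D, ∃ γ ∈ sqAvoid T σ₀ D,
      (∀ i ∈ D, γ i = σ i) ∧ ∀ i, i ∉ D → γ i = τ i := fun σ hσ τ hτ => exists_sqGlue hσ hτ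
  choose! gl hgl hglD hglN using hex
  rw [sqPer, sum_mul_sum, ← sum_product']
  refine sum_nbij' (fun ρ => (gl ρ σ₀, gl σ₀ ρ)) (fun p => gl p.1 p.2) (fun ρ hρ => ?_) (fun p hp => ?_)
    (fun ρ hρ => ?_) (fun p hp => ?_) (fun ρ hρ => ?_)
  · have hA : gl ρ σ₀ ∈ avoid (sharp T σ₀ D) :=
      mem_avoid_sharp.2 ⟨fun i hi => by rw [hglD ρ hρ σ₀ hσ₀ i hi]; exact ((mem_sqAvoid.1 hρ) i hi).1,
        fun i hi => hglN ρ hρ σ₀ hσ₀ i hi⟩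
    have hB : gl σ₀ ρ ∈ (sqAvoid T σ₀ D).filter (fun σ => ∀ i ∈ D, σ i = σ₀ i) :=
      mem_filter.2 ⟨hgl σ₀ hσ₀ ρ hρ, fun i hi => hglD σ₀ hσ₀ ρ hρ i hi⟩
    exact mem_product.2 ⟨hA, hB⟩
  · obtain ⟨h1, h2⟩ := mem_product.1 hp
    exact hgl _ (mem_sqAvoid_of_mem_avoid_sharp h1) _ (mem_filter.1 h2).1
  · have h1 := hgl ρ hρ σ₀ hσ₀
    have h2 := hgl σ₀ hσ₀ ρ hρ
    refine Equiv.ext fun i => ?_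
    show gl (gl ρ σ₀) (gl σ₀ ρ) i = ρ i
    by_cases hi : i ∈ D
    · rw [hglD _ h1 _ h2 i hi, hglD ρ hρ σ₀ hσ₀ i hi]
    · rw [hglN _ h1 _ h2 i hi, hglN σ₀ hσ₀ ρ hρ i hi]
  · obtain ⟨h1, h2⟩ := mem_product.1 hp
    have hp1 := mem_sqAvoid_of_mem_avoid_sharp h1
    have hA1 := (mem_avoid_sharp.1 h1).2
    obtain ⟨hp2, hB2⟩ := mem_filter.1 h2
    have h3 := hgl _ hp1 _ hp2
    refine Prod.ext (Equiv.ext fun i => ?_) (Equiv.ext fun i => ?_)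
    · show gl (gl p.1 p.2) σ₀ i = p.1 i
      by_cases hi : i ∈ D
      · rw [hglD _ h3 σ₀ hσ₀ i hi, hglD _ hp1 _ hp2 i hi]
      · rw [hglN _ h3 σ₀ hσ₀ i hi, hA1 i hi]
    · show gl σ₀ (gl p.1 p.2) i = p.2 i
      by_cases hi : i ∈ D
      · rw [hglD σ₀ hσ₀ _ h3 i hi, hB2 i hi]
      · rw [hglN σ₀ hσ₀ _ h3 i hi, hglN _ hp1 _ hp2 i hi]
  · show (∏ i ∈ D, X (ρ i, i)) * g ρ = (∏ i ∈ D, X (gl ρ σ₀ i, i)) * g (gl σ₀ ρ)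
    have e1 : ∏ i ∈ D, (X (gl ρ σ₀ i, i) : MvPolynomial (Fin m × Fin m) R) = ∏ i ∈ D, X (ρ i, i) :=
      prod_congr rfl fun i hi => by rw [hglD ρ hρ σ₀ hσ₀ i hi]
    rw [e1, hg (gl σ₀ ρ) ρ fun i hi => hglN σ₀ hσ₀ ρ hρ i hi]

end Semiring

/-! ## 3. The padded pattern and the degree count -/

/-- Membership in `T̂`. [this file] -/
theorem mem_pad {x : Fin m × Fin m} : x ∈ pad T σ₀ D ↔ x ∈ T ∨ ¬ (σ₀.symm x.1 ∈ D ∧ x.2 ∈ D) := by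
  simp only [pad, mem_union, mem_filter, mem_univ, true_and]

/-- `T ⊆ T̂`. [this file] -/
theorem subset_pad : T ⊆ pad T σ₀ D := fun _ hx => mem_pad.2 (Or.inl hx)

/-- The cells off `T̂`: the `T`-free cells of the square. [this file] -/
theorem not_mem_pad_iff {k i : Fin m} : (k, i) ∉ pad T σ₀ D ↔ (k, i) ∉ T ∧ σ₀.symm k ∈ D ∧ i ∈ D := by
  simp only [mem_pad, not_or, not_not]

/-- A permutation has at most `|D|` cells off `T̂` … [this file] -/
theorem card_filter_not_mem_pad_le (ρ : Equiv.Perm (Fin m)) :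
    (univ.filter fun i => (ρ i, i) ∉ pad T σ₀ D).card ≤ D.card :=
  card_le_card fun _ hi => (not_mem_pad_iff.1 (mem_filter.1 hi).2).2.2

/-- … with equality exactly for the square permutations. [this file] -/
theorem card_filter_not_mem_pad_eq_iff (ρ : Equiv.Perm (Fin m)) :
    (univ.filter fun i => (ρ i, i) ∉ pad T σ₀ D).card = D.card ↔ ρ ∈ sqAvoid T σ₀ D := by
  constructor
  · intro h
    have heq : (univ.filter fun i => (ρ i, i) ∉ pad T σ₀ D) = D :=
      eq_of_subset_of_card_le (fun i hi => (not_mem_pad_iff.1 (mem_filter.1 hi).2).2.2) h.ge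
    refine mem_sqAvoid.2 fun i hi => ?_
    rw [← heq] at hi
    have h' := not_mem_pad_iff.1 (mem_filter.1 hi).2
    exact ⟨h'.1, h'.2.1⟩
  · intro h
    refine congrArg Finset.card (Finset.ext fun i => ?_)
    rw [mem_filter, not_mem_pad_iff]
    exact ⟨fun h' => h'.2.2.2,
      fun hi => ⟨mem_univ _, ((mem_sqAvoid.1 h) i hi).1, ((mem_sqAvoid.1 h) i hi).2, hi⟩⟩

/-- The degree of the `ρ`-term of `Φ_{T̂}(per_m)` is at most `|D|` … [this file] -/
theorem degree_term_le (ρ : Equiv.Perm (Fin m)) :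
    (∑ i : Fin m, if (ρ i, i) ∉ pad T σ₀ D then 1 else 0) ≤ D.card := by
  simp only [sum_boole, Nat.cast_id]
  exact card_filter_not_mem_pad_le ρ

/-- … and equals `|D|` exactly for the square permutations. [this file] -/
theorem degree_term_eq_iff (ρ : Equiv.Perm (Fin m)) :
    (∑ i : Fin m, if (ρ i, i) ∉ pad T σ₀ D then 1 else 0) = D.card ↔ ρ ∈ sqAvoid T σ₀ D := by
  simp only [sum_boole, Nat.cast_id]
  exact card_filter_not_mem_pad_eq_iff ρ

/-! ## 4. The top form of `Φ_{T̂}(per_m)` -/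

section Spec
variable {K : Type*} [Field K] {K' : Type*} [Field K'] (ι : MvPolynomial (Fin m × Fin m) K →+* K')

/-- The degree-`|D|` component of the `ρ`-term: the term itself for a square permutation, else `0`.
[this file] -/
theorem homogeneousComponent_prod_specVar_pad (ρ : Equiv.Perm (Fin m)) :
    homogeneousComponent D.card (∏ i, specVar ι (pad T σ₀ D) (ρ i, i)) =
      if ρ ∈ sqAvoid T σ₀ D then ∏ i, specVar ι (pad T σ₀ D) (ρ i, i) else 0 := by
  rw [homogeneousComponent_of_mem
    ((mem_homogeneousSubmodule _ _).2 (prod_specVar_isHomogeneous ι (pad T σ₀ D) ρ))]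
  by_cases hρ : ρ ∈ sqAvoid T σ₀ D
  · rw [if_pos ((degree_term_eq_iff ρ).2 hρ).symm, if_pos hρ]
  · rw [if_neg (fun h => hρ ((degree_term_eq_iff ρ).1 h.symm)), if_neg hρ]

/-- The `ρ`-term of a square permutation: variables on `D`, constants off `D`. [this file] -/
theorem prod_specVar_pad_of_mem {ρ : Equiv.Perm (Fin m)} (hρ : ρ ∈ sqAvoid T σ₀ D) :
    ∏ i, specVar ι (pad T σ₀ D) (ρ i, i) =
      (∏ i ∈ D, (X (ρ i, i) : MvPolynomial (Fin m × Fin m) K')) * C (ι (∏ i ∈ Dᶜ, X (ρ i, i))) := by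
  rw [← prod_mul_prod_compl D (fun i => specVar ι (pad T σ₀ D) (ρ i, i)), map_prod, map_prod]
  congr 1
  · exact prod_congr rfl fun i hi => by
      rw [specVar, if_neg (not_mem_pad_iff.2 ⟨((mem_sqAvoid.1 hρ) i hi).1, ((mem_sqAvoid.1 hρ) i hi).2, hi⟩)]
  · exact prod_congr rfl fun i hi => by
      rw [specVar, if_pos (mem_pad.2 (Or.inr fun h => (mem_compl.1 hi) h.2))]

/-- **The degree-`|D|` component of `Φ_{T̂}(per_m)` is `Q□ · ι(outer permanent)`.** [this file] -/
theorem homogeneousComponent_spec_pad (hfree : ∀ i ∈ D, (σ₀ i, i) ∉ T) :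
    homogeneousComponent D.card (spec ι (pad T σ₀ D) (perPoly (Fin m) K)) =
      sqPer K' T σ₀ D * C (ι (outPer K T σ₀ D)) := by
  rw [spec_perPoly, map_sum,
    Finset.sum_congr rfl fun ρ _ => homogeneousComponent_prod_specVar_pad (T := T) (σ₀ := σ₀) (D := D) ι ρ,
    Finset.sum_ite_mem_eq,
    Finset.sum_congr rfl fun ρ hρ => prod_specVar_pad_of_mem (T := T) (σ₀ := σ₀) (D := D) ι hρ,
    sum_sqAvoid_eq hfree (fun ρ => C (ι (∏ i ∈ Dᶜ, X (ρ i, i)))) fun σ τ h => ?_, outPer, map_sum,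
    map_sum]
  exact congrArg (fun q => C (ι q)) (prod_congr rfl fun i hi => by rw [h i (mem_compl.1 hi)])

/-- `deg Φ_{T̂}(per_m) ≤ |D|`. [this file] -/
theorem totalDegree_spec_pad_le : (spec ι (pad T σ₀ D) (perPoly (Fin m) K)).totalDegree ≤ D.card := by
  rw [spec_perPoly]
  refine (totalDegree_finsetSum _ _).trans (Finset.sup_le fun ρ _ => ?_)
  exact (prod_specVar_isHomogeneous ι (pad T σ₀ D) ρ).totalDegree_le.trans (degree_term_le ρ)

/-- **THE TOP FORM OF `Φ_{T̂}(per_m)` IS `Q□ · ι(outer permanent)`** (`ι` injective): a nonzero constant times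
the square permanent. [this file] -/
theorem topForm_spec_pad (hι : Function.Injective ι) (hfree : ∀ i ∈ D, (σ₀ i, i) ∉ T) :
    topForm (spec ι (pad T σ₀ D) (perPoly (Fin m) K)) = sqPer K' T σ₀ D * C (ι (outPer K T σ₀ D)) := by
  have hι0 : ι (outPer K T σ₀ D) ≠ 0 := fun h =>
    outPer_ne_zero hfree (hι (h.trans (map_zero ι).symm))
  have hne : sqPer K' T σ₀ D * C (ι (outPer K T σ₀ D)) ≠ 0 :=
    mul_ne_zero (sqPer_ne_zero hfree) (C_ne_zero.2 hι0)
  have hdeg : (spec ι (pad T σ₀ D) (perPoly (Fin m) K)).totalDegree = D.card := by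
    refine le_antisymm (totalDegree_spec_pad_le ι) ?_
    by_contra hlt
    push Not at hlt
    exact hne (by rw [← homogeneousComponent_spec_pad ι hfree, homogeneousComponent_eq_zero _ _ hlt])
  unfold topForm
  rw [hdeg, homogeneousComponent_spec_pad ι hfree]

end Spec

/-! ## 5. The block permanents of `T♯` divide the square permanent -/

/-- **The block permanents of `T♯` at square rows divide `Q□`** (`Q ∣ zpPer T♯ = Q□ · ∏_{i ∉ D} Y_(σ₀ i, i)`,
`Q` prime, and `Q` involves the variable `Y_(σ₀ i, i)`, `i ∈ D`, so divides none of the `Y_(σ₀ j, j)`,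
`j ∉ D`). [cite: BrualdiRyser1991, Thm. 4.2.7] -/
theorem blockPer_dvd_sqPer {F : Type*} [Field F] (hfree : ∀ i ∈ D, (σ₀ i, i) ∉ T) {i : Fin m}
    (hi : i ∈ D) : blockPer F (sharp T σ₀ D) (σ₀ i) σ₀ ∣ sqPer F T σ₀ D := by
  have hσ₀ := self_mem_avoid_sharp hfree
  have hQ := blockPer_prime (F := F) hσ₀ (σ₀ i)
  have hd : blockPer F (sharp T σ₀ D) (σ₀ i) σ₀ ∣ sqPer F T σ₀ D * ∏ j ∈ Dᶜ, X (σ₀ j, j) := by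
    rw [← zpPer_sharp]
    exact blockPer_dvd_zpPer _ hσ₀ _
  refine (hQ.dvd_or_dvd hd).resolve_right fun hd' => ?_
  obtain ⟨j, hj, S, hS⟩ := hQ.exists_mem_finset_dvd hd'
  have hS' : (X (σ₀ j, j) : MvPolynomial (Fin m × Fin m) F) = blockPer F (sharp T σ₀ D) (σ₀ i) σ₀ * S := hS
  have hS0 : S ≠ 0 := by
    rintro rfl
    rw [mul_zero] at hS'
    exact X_ne_zero _ hS'
  have hv : ((σ₀ i, i) : Fin m × Fin m) ∈ (blockPer F (sharp T σ₀ D) (σ₀ i) σ₀).vars :=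
    (mem_vars_blockPer_iff hσ₀).2 ⟨apply_mem_adm hσ₀ i, self_mem_rowBlock _ _⟩
  have hv' : ((σ₀ i, i) : Fin m × Fin m) ∈ (X (σ₀ j, j) : MvPolynomial (Fin m × Fin m) F).vars := by
    rw [mem_vars_iff_degreeOf_ne_zero] at hv ⊢
    rw [hS', degreeOf_mul_eq hQ.ne_zero hS0]
    omega
  rw [vars_X, mem_singleton, Prod.mk.injEq] at hv'
  exact (mem_compl.1 hj) (hv'.2 ▸ hi)

end

end Summit.ValiantsHypothesis.ValiantsHypothesis.Theorems.DefinabilityGapSquarePermanent
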